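/-
Copyright (c) 2026 the pub-hodgecm-mathlib formalisation cell (harness21).  R90-TF SLAB, section S10 (Rogawski 1990, §13.6–13.8 read at `v`),
prover R90-C138-p08 (g0) — DEAL #9 (M5) (R90-C138-plan (g2) 2026-09-05T00:23:15Z); h413 = `stmt-HodgeConjecture-24833`, route `HCCMUnconditional`.
-/
import Summits.HodgeConjecture.HodgeConjecture.Theorems.R90S10UnramCharIdentityLetterDefs   -- ★ p863563 (W1-H9): (α) `SphericalConstituentTraceLetter`, (β″) `LocalCharTransferLetter`, (M3) `UnramCharIdentityLetter`; brings ★ C2 + ★ `HeckeEigencharacterPackage`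
import HarnessLib

/-!
# R90-TF ∕ S10 — (M5) «A SPHERICAL CLASS IS DETERMINED BY ITS HECKE EIGENCHARACTER», READ BACK IN S10 CURRENCY: the letter (α) PINS the class, and (α) ∕ (M3) TRANSFER
# along a common eigencharacter (`Theorems/R90S10SphericalClassOfEigenchar.lean`; ns `Summit.HodgeConjecture.HodgeConjecture.R90.S10`; LAW L9: ★ `Theorems` imports only;
# THEOREMS ONLY — no `def`, no instance, no notation, no `sorry`)

Print: [Rogawski1990] §13.6 p. 209 «`t_{π_v}` is the homomorphism by which `𝓗_v` acts on the `K_v`-fixed vector of `π_v`»; §13.7 p. 211 (separating by Hecke eigenvalues);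
§13.8 p. 219 L3 «`π_v = ξ_H(ρ_v)` for all `v ≠ w` and all `π` occurring in the sum».  [CartierCorvallis1979] §IV.1 Thm. 4.1, Cor. 4.1–4.2 (a `K`-spherical irreducible admissible
representation is determined by its Hecke eigencharacter); [Bump1997] §4.2 Prop. 4.2.3 (b).

## WHY (p08 census 00:19Z, RULING W1-H9 follow-up (M5), DEAL #9)
★ `liesOver_of_unramCharIdentityLetter` (W1-H9) reduces «`π_w = ξ_H(ρ_w)`» (★ C2 `LiesOver`) to (M3) `UnramCharIdentityLetter … π_w ρ_w = ∃ I, (α) ∧ (β″)`.  In the (P-rig) application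
the class `π_w := πc w` is GIVEN (the local class of a contributing member, `K_w`-spherical), while the payer of (β″) produces `I = i_G(χ̃ μ̃)` with ITS OWN spherical constituent
`π_sph`; the two are identified by their common Hecke eigencharacter `(t₀)_w` (★ `IrrClass.IsSphericalWith K_w νQw t`: «same e.v.p. at a place»).  The identification is ★
[CartierCorvallis1979 §IV.1]: `IrrClass.eq_of_isSphericalWith` ∕ `IrrClass.eq_of_smoothTrace_indicator_doubleCoset_eq` (`Literature/NumberTheory/Automorphic/HeckeEigencharacterPackage.lean`
:412 ∕ :384).  This file reads it back in S10 currency: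
* `eq_of_sphericalConstituentTraceLetter` — **(α) PINS THE CLASS**: two admissible classes satisfying (α) for the same `I` are EQUAL (their characters agree on every `𝟙_{K g K}`,
  a compactly supported level-`K` hence `IsLocSmooth` test function, ★ `isLevel_indicator_doubleCoset` + ★ `IsLevel.isLocallyConstant`; then ★ rigidity).  So «THE spherical
  constituent» in (α)'s name is honest: at most one class per `I`.
* `sphericalConstituentTraceLetter_of_isSphericalWith` — **(α) TRANSFERS ALONG A COMMON EIGENCHARACTER**: if `π`, `π′` are admissible and `K_w`-spherical WITH THE SAME
  eigencharacter `t` (★ `IsSphericalWith`) and `π′` satisfies (α) for `I`, so does `π` (indeed `π = π′`, ★ `eq_of_isSphericalWith`).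
* `unramCharIdentityLetter_of_isSphericalWith` — the same transfer for (M3): `UnramCharIdentityLetter … π′ ρ_w → UnramCharIdentityLetter … π ρ_w` — exactly the step
  «`πc w` has e.v.p. `(t₀)_w` = the e.v.p. of `ξ_H(ρ_w)`'s spherical member ⇒ `πc w` IS that member» of p. 219 L3, so that (P-rig)'s payer applies (M3) to the GIVEN class.
Hypotheses carried honestly: `K_w` compact open, `νQw(K_w) ≠ 0` (unit volume at the datum's pins), admissibility of both classes (★ `IrrClass.IsAdmissible`; true for every
irreducible smooth representation of the `p`-adic group — [Bernstein], not re-proved here).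
HONEST LABEL: three bookkeeping theorems over ★ rigidity; pay no socket; HC_CM is proved only modulo the 7 printed citations (2 remaining named inputs: hLiu418 =
`stmt-HodgeConjecture-24832`, h413 = `stmt-HodgeConjecture-24833`) until rung 0 closes; REL ≠ ★ ≠ BUILT.
-/

set_option autoImplicit false
set_option linter.dupNamespace false

noncomputable section

open scoped RestrictedProduct Matrix MatrixGroups
open Filter MeasureTheory NumberField IsDedekindDomain CompactlySupported
open Literature.NumberTheory.Rogawski1990 Literature.NumberTheory.Automorphic Literature.NumberTheory.Automorphic.UnitaryGroup
open Literature.NumberTheory.Automorphic.UnitaryGroup.CotangentForms Literature.NumberTheory.GaloisRepresentations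
open Summit.HodgeConjecture.HodgeConjecture.Cruxes.H413.K2E1TraceFormulaBeta

namespace Summit.HodgeConjecture.HodgeConjecture.R90.S10

section Rigidity

variable (L : Type) [Field L] [NumberField L] [IsCMField L] (w : Pl L)
  [MeasurableSpace (Gqs L w)] [BorelSpace (Gqs L w)] (KG : Subgroup (Gqs L w)) (νQw : Measure (Gqs L w)) [νQw.IsHaarMeasure]

/-- **(M5-a) THE LETTER (α) PINS THE CLASS** — two ADMISSIBLE classes `π`, `π′` of `G_w` that are both «the `K_w`-spherical constituent of `I` carrying its `K_w`-level trace»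
(★ `SphericalConstituentTraceLetter L w K_w νQw I ·`) are EQUAL: their characters agree on every double-coset indicator `𝟙_{K_w g K_w}` (a compactly supported
level-`K_w`, hence locally constant, test function — ★ `isLevel_indicator_doubleCoset`, ★ `IsLevel.isLocallyConstant`), both being `Tr I(𝟙_{K_w g K_w})`, and a
`K_w`-spherical admissible class is determined by these values (★ `IrrClass.eq_of_smoothTrace_indicator_doubleCoset_eq`).  `K_w` compact open with `νQw(K_w) ≠ 0`.
[cite: CartierCorvallis1979, §IV.1 Thm. 4.1, Cor. 4.1] [cite: Bump1997, §4.2 Prop. 4.2.3 (b)] [cite: Rogawski1990, §13.6 p. 209] -/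
theorem eq_of_sphericalConstituentTraceLetter {W : Type} [AddCommGroup W] [Module ℂ W] (I : Representation ℂ (Gqs L w) W)
    (hKo : IsOpen (KG : Set (Gqs L w))) (hKc : IsCompact (KG : Set (Gqs L w))) (hμK : νQw.real (KG : Set (Gqs L w)) ≠ 0)
    {π π' : IrrClass (Gqs L w)} (hadm : π.IsAdmissible) (hadm' : π'.IsAdmissible)
    (h : SphericalConstituentTraceLetter L w KG νQw I π) (h' : SphericalConstituentTraceLetter L w KG νQw I π') : π = π' := by
  refine IrrClass.eq_of_smoothTrace_indicator_doubleCoset_eq νQw hadm hadm' hKo hKc hμK h.1 h'.1 fun g => ?_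
  obtain ⟨hlev, hcs⟩ := isLevel_indicator_doubleCoset (K := KG) hKo hKc g
  rw [h.2 _ ⟨hlev.isLocallyConstant, hcs⟩ hlev, h'.2 _ ⟨hlev.isLocallyConstant, hcs⟩ hlev]

/-- **(M5-b) (α) TRANSFERS ALONG A COMMON HECKE EIGENCHARACTER** — if the admissible classes `π`, `π′` are `K_w`-spherical WITH THE SAME eigencharacter `t`
(★ `IrrClass.IsSphericalWith K_w νQw t`, «same e.v.p. at `w`») and `π′` is the `K_w`-spherical constituent of `I` carrying its `K_w`-level trace, then so is `π` — indeed `π = π′`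
(★ `IrrClass.eq_of_isSphericalWith`).  This is «`t_{π_w}` determines `π_w`» (p. 209) applied to the GIVEN local class of a contributing member versus the spherical member of `ξ_H(ρ_w)`.
[cite: CartierCorvallis1979, §IV.1 Cor. 4.1–4.2] [cite: Rogawski1990, §13.6 p. 209; §13.8 p. 219 L3] -/
theorem sphericalConstituentTraceLetter_of_isSphericalWith {W : Type} [AddCommGroup W] [Module ℂ W] (I : Representation ℂ (Gqs L w) W)
    (hKo : IsOpen (KG : Set (Gqs L w))) (hKc : IsCompact (KG : Set (Gqs L w))) (hμK : νQw.real (KG : Set (Gqs L w)) ≠ 0)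
    {π π' : IrrClass (Gqs L w)} (hadm : π.IsAdmissible) (hadm' : π'.IsAdmissible) {t : (Gqs L w → ℂ) → ℂ}
    (ht : π.IsSphericalWith KG νQw t) (ht' : π'.IsSphericalWith KG νQw t)
    (h' : SphericalConstituentTraceLetter L w KG νQw I π') : SphericalConstituentTraceLetter L w KG νQw I π := by
  rw [IrrClass.eq_of_isSphericalWith νQw hadm hadm' hKo hKc hμK ht ht']
  exact h'

/-- **(M5-c) (M3) TRANSFERS ALONG A COMMON HECKE EIGENCHARACTER** — the unramified character identity `UnramCharIdentityLetter … π′ ρ_w` for the spherical member `π′` of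
`ξ_H(ρ_w)` passes to every admissible `K_w`-spherical class `π` with the SAME eigencharacter (`π = π′`): the step «`πc w` has e.v.p. `(t₀)_w` ⇒ `πc w = ξ_H(ρ_w)`» of p. 219 L3,
after which ★ `liesOver_of_unramCharIdentityLetter` gives ★ `LiesOver … (πc w) (𝔥.ρ w)` for the GIVEN class. [cite: Rogawski1990, §13.8 p. 219 L3; §13.6 p. 209]
[cite: CartierCorvallis1979, §IV.1 Cor. 4.1–4.2] -/
theorem unramCharIdentityLetter_of_isSphericalWith (μ : HeckeCharacter L) [MeasurableSpace (HLoc L w)]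
    [∀ a : HLoc L w, MeasurableSpace (HLoc L w ⧸ Subgroup.centralizer ({a} : Set (HLoc L w)))]
    [∀ γ : Gqs L w, MeasurableSpace (Gqs L w ⧸ Subgroup.centralizer ({γ} : Set (Gqs L w)))]
    (KHw : Subgroup (HLoc L w)) (νHw : Measure (HLoc L w)) (mHw : OrbitalMeasureFamily (HLoc L w)) (mQw : OrbitalMeasureFamily (Gqs L w))
    {Vw : Type} [AddCommGroup Vw] [Module ℂ Vw] (ρw : Representation ℂ (HLoc L w) Vw)
    (hKo : IsOpen (KG : Set (Gqs L w))) (hKc : IsCompact (KG : Set (Gqs L w))) (hμK : νQw.real (KG : Set (Gqs L w)) ≠ 0)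
    {π π' : IrrClass (Gqs L w)} (hadm : π.IsAdmissible) (hadm' : π'.IsAdmissible) {t : (Gqs L w → ℂ) → ℂ}
    (ht : π.IsSphericalWith KG νQw t) (ht' : π'.IsSphericalWith KG νQw t)
    (h' : UnramCharIdentityLetter L μ w KG KHw νQw νHw mHw mQw π' ρw) : UnramCharIdentityLetter L μ w KG KHw νQw νHw mHw mQw π ρw := by
  rw [IrrClass.eq_of_isSphericalWith νQw hadm hadm' hKo hKc hμK ht ht']
  exact h'

end Rigidity

end Summit.HodgeConjecture.HodgeConjecture.R90.S10

end
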